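import Summits.Langlands.Langlands.Theses.EisensteinGelfandKirillov
import Literature.NumberTheory.Automorphic.ResGLnCohomology
import Literature.NumberTheory.Automorphic.ResGL2EigensystemCuspidalOrEisenstein
import Literature.NumberTheory.Automorphic.ReducibleGaloisRepOfCharacters
import Summits.Langlands.Langlands.Theorems.SkinnerWilesDefectOneProModularOrdinaryClassicalDominantPointsClassical
import Summits.Langlands.Langlands.Theorems.SkinnerWilesDefectOneProModularOrdinaryClassicalSatakeDictionary

/-!
# Stub S5 `stub_eichlerShimuraHarder` of line `torsion-weight-exchange`, crux
# `EisensteinGelfandKirillov.CrystallineProModularClassical` (stmt-Langlands-18274)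

The EICHLER–SHIMURA–HARDER DICTIONARY WITH EISENSTEIN EXCLUSION for `GL₂` over a totally real field
`F`, on the Betti receptacle `ResGLnCohomology.levelCohomology (PadicAlgCl p) 2 F 𝔫 λ q`
(`H^q(GL₂(F)⁺, Fun(GL₂(𝔸_F^∞)/K_f(𝔫), E_λ(ℚ̄_p)))`, any `λ`, any `q`, `𝔫 ≠ 0`): a non-zero simultaneous
eigenclass of the good `T_{v,1}, T_{v,2}` (`v ∉ S` finite, `v ∤ 𝔫`) whose eigenvalues are associated
(`IsAssociatedFamily`, arithmetic Frobenius) with an IRREDUCIBLE `ρ : Γ_F → GL₂(ℚ̄_p)` comes from a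
cuspidal `L`-algebraic `π` on `GL₂(𝔸_F)` with Satake–Frobenius matching at almost all places
(`Summit.Langlands.SatakeFrobCompatibleAt`).  Registered signature (lead rev 3): Harder's exhaustion
theorem enters as the FIRST HYPOTHESIS, the tree's named fact
`Literature.NumberTheory.Automorphic.ResGLnCohomology.Harder1987_eigensystem_cuspidalOrEisenstein`
(`ResGL2EigensystemCuspidalOrEisenstein.lean`, p159515: a.e.-eigenclass ⇒ regular algebraic cuspidal
`π₀` with Satake identities OR a pair of algebraic Größencharaktere; Harder 1987 §2.6 Thm. 1, §3.1–3.2,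
§4.2 Thm. 2; Franke 1998 Thm. 18), supplied in the crux composition by the separate literature-debt stub
`stub_harder1987`.  Everything else is PROVED here from the tree:

* `not_grossencharakterPair_of_isIrreducible` (Eisenstein exclusion): Weil's `p`-adic characters of
  `ψ₁, ψ₂` (`exists_galoisCharacter_of_isGrossencharakter`), `FramedGaloisRep.exists_sum_of_characters`,
  `heckeFrobPoly_two_eq`, then Chebotarev + Brauer–Nesbitt
  (`FramedGaloisRep.nonempty_equiv_of_hasFrobCharpolyAt_eventually chebotarev_artinRep_holds`) against
  the irreducible `ρ` (`Representation.isIrreducible_of_equiv`);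
* `exists_isLAlgebraic_satakeFrobCompatible_of_cuspidal` (C→L dictionary): `π := (π₀ ⊗ ω_{π₀}⁻¹∘det) ⊗
  |det|^{1/2}` is cuspidal `L`-algebraic with `SatakeFrobCompatibleAt ι π ρ v` a.e. — the argument of
  the landed `stub_satakeDictionary` (route SkinnerWilesDefectOne) rerun with `IsAssociatedFamily 2 S a ρ`;
* `stub_eichlerShimuraHarder_of_harder1987` (the dichotomy applied with `E = ℚ̄_p` transported along
  `ι`; the eigen-equations at `v ∉ S ∪ supp 𝔫` are cofinite), and the registered
  `stub_eichlerShimuraHarder` (one line from it).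

Why ONE disjunctive fact and not the Bianchi pair "interior ⇒ cuspidal" + "non-interior ⇒ reducible":
over a totally real `F` of degree `≥ 2` the interior cohomology with one-dimensional coefficients
contains the residual classes `ω_J` of `φ∘det` (Harder (3.2.5)), which are not cuspidal; and the Bianchi
facts / their proved Borel-stratum argument are `finrank ℚ F = 2` / `IsTotallyComplex` /
`ParallelWeight`-receptacle only.  (S5 worker of lead prover-line-stmt-Langlands-18274-a2-0, 2026-08-17;
assembled for landing by the lead.)
-/

namespace Summit.Langlands.Langlands.Cruxes.CrystallineProModularClassical.TorsionWeightExchange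

set_option linter.dupNamespace false

open Summit.Langlands.Langlands.Theses.EisensteinGelfandKirillov
open Literature.NumberTheory.Automorphic Literature.NumberTheory.GaloisRepresentations
open Literature.NumberTheory.Automorphic.BigHeckeGLn Literature.NumberTheory.PAdicHodge
open NumberField IsDedekindDomain Filter Polynomial
open Summit.Langlands.Langlands.Cruxes.ProModularOrdinaryClassical.TopDegreeExactControl
  (esymm_one_pair esymm_two_pair prod_pair halfTwist_mul_sqrt valueAtUniformizer_inv
    valueAtUniformizer_ne_zero heckeFrobPoly_two_eq_arithFrobPolyOfSatake isSemisimple_of_isIrreducible)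
open scoped Classical

noncomputable section

/-! ## The one unproved published input

It is the tree's named fact
`Literature.NumberTheory.Automorphic.ResGLnCohomology.Harder1987_eigensystem_cuspidalOrEisenstein`
(`Literature/NumberTheory/Automorphic/ResGL2EigensystemCuspidalOrEisenstein.lean`, landed by this
worker as p159515; Harder 1987 Thm. 1 / Thm. 2 / (3.1.1)–(3.2.5), Franke 1998 Thm. 18): an
a.e.-eigenclass `c ≠ 0` of `T_{w,1}, T_{w,2}` in `ResGLnCohomology.levelCohomology E 2 F 𝔫 λ q`
(`F` totally real, `𝔫 ≠ 0`, any `λ`, any `q`, `E ≃+* ℂ`) carries either the eigensystem of a regular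
algebraic cuspidal `π₀` (`ι a_{w,1} = q_w^{1/2} e₁(α_w)`, `ι a_{w,2} = e₂(α_w)` a.e.) or that of a pair
of algebraic Größencharaktere `ψ₁, ψ₂` (`ι a_{w,1} = ψ₁(w) + ψ₂(w)`, `N(w) ι a_{w,2} = ψ₁(w) ψ₂(w)`
a.e.).  It is taken below as the hypothesis `hH`; nothing is vendored in this file. -/

/-! ## X3 — Eisenstein exclusion (proved): a Größencharakter pair contradicts irreducibility -/

/-- All but finitely many `v` do not contain the rational prime `ℓ ≠ 0` (as in
`BianchiBoundaryEigensystemReducible`, restated to keep the imports minimal). [folklore] -/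
theorem eventually_natCast_not_mem_asIdeal {F : Type} [Field F] [NumberField F] {ℓ : ℕ} (hℓ : ℓ ≠ 0) :
    ∀ᶠ v : HeightOneSpectrum (𝓞 F) in Filter.cofinite, (ℓ : 𝓞 F) ∉ v.asIdeal := by
  have hne : Ideal.span {(ℓ : 𝓞 F)} ≠ ⊥ := by
    rw [Ne, Ideal.span_singleton_eq_bot]
    exact_mod_cast hℓ
  refine Filter.mem_of_superset (Ideal.finite_factors hne).compl_mem_cofinite ?_
  intro v hv hmem
  exact hv (Ideal.dvd_span_singleton.2 hmem)

/-- All but finitely many `v` satisfy `¬ 𝔣 ≤ v` (`𝔣 ≠ 0`). [folklore] -/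
theorem eventually_not_le_asIdeal {F : Type} [Field F] [NumberField F] {𝔣 : Ideal (𝓞 F)}
    (h𝔣 : 𝔣 ≠ ⊥) : ∀ᶠ v : HeightOneSpectrum (𝓞 F) in Filter.cofinite, ¬ 𝔣 ≤ v.asIdeal := by
  refine Filter.mem_of_superset (Ideal.finite_factors h𝔣).compl_mem_cofinite ?_
  intro v hv hle
  exact hv (Ideal.dvd_iff_le.2 hle)

/-- **An eigensystem associated with an IRREDUCIBLE `ρ` is not that of a pair of algebraic
Größencharaktere.**  If `ρ : Γ_F → GL₂(ℚ̄_p)` is irreducible and associated with `a` off the finite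
set `S` (`IsAssociatedFamily`: unramified, arithmetic Frobenius polynomial
`X² − a_{w,1} X + N(w) a_{w,2}`), then no two Größencharaktere `ψ₁, ψ₂` satisfy
`ι a_{w,1} = ψ₁(w) + ψ₂(w)`, `N(w) ι a_{w,2} = ψ₁(w) ψ₂(w)` a.e.: Weil's `p`-adic characters `r_i` of
`ψ_i⁻¹` (`exists_galoisCharacter_of_isGrossencharakter`, arithmetic Frobenius `ι⁻¹ ψ_i(w)`) give the
semisimple reducible `σ = r₁ ⊕ r₂` (`FramedGaloisRep.exists_sum_of_characters`) with the same
Frobenius polynomials as `ρ` a.e. (`heckeFrobPoly_two_eq`), so `ρ ≃ σ` by Chebotarev +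
Brauer–Nesbitt (`FramedGaloisRep.nonempty_equiv_of_hasFrobCharpolyAt_eventually`, with the
discharged `chebotarev_artinRep_holds`), contradicting irreducibility
(`Representation.isIrreducible_of_equiv`). [folklore] -/
theorem not_grossencharakterPair_of_isIrreducible {F : Type} [Field F] [NumberField F] {p : ℕ}
    [Fact p.Prime] (ι : PadicAlgCl p ≃+* ℂ) (ρ : FramedGaloisRep F (PadicAlgCl p) 2)
    (hirr : ρ.toGaloisRep.IsIrreducible) {S : Set (HeightOneSpectrum (𝓞 F))} (hS : S.Finite)
    {a : HeightOneSpectrum (𝓞 F) → ℕ → PadicAlgCl p} (hass : IsAssociatedFamily 2 S a ρ)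
    {𝔣 : Ideal (𝓞 F)} (h𝔣 : 𝔣 ≠ ⊥) {p₁ q₁ p₂ q₂ : InfinitePlace F → ℤ}
    {ψ₁ ψ₂ : HeightOneSpectrum (𝓞 F) → ℂ} (hψ₁ : IsGrossencharakter 𝔣 p₁ q₁ ψ₁)
    (hψ₂ : IsGrossencharakter 𝔣 p₂ q₂ ψ₂)
    (hev : ∀ᶠ w in Filter.cofinite, ι (a w 1) = ψ₁ w + ψ₂ w ∧
      ((Ideal.absNorm w.asIdeal : ℕ) : ℂ) * ι (a w 2) = ψ₁ w * ψ₂ w) : False := by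
  -- Weil's characters of `ψ₁⁻¹, ψ₂⁻¹`: arithmetic Frobenius `ι⁻¹((ψ_i(w)⁻¹)⁻¹) = ι⁻¹ ψ_i(w)`
  obtain ⟨r₁, hr₁⟩ := exists_galoisCharacter_of_isGrossencharakter h𝔣 hψ₁.inv ι
  obtain ⟨r₂, hr₂⟩ := exists_galoisCharacter_of_isGrossencharakter h𝔣 hψ₂.inv ι
  obtain ⟨σ, hσss, hσred, hσ⟩ := FramedGaloisRep.exists_sum_of_characters r₁ r₂
  -- `ρ` and `σ` have the same Frobenius polynomials at almost all places
  have hboth : ∀ᶠ v : HeightOneSpectrum (𝓞 F) in cofinite,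
      ρ.IsUnramifiedAt v ∧ σ.IsUnramifiedAt v ∧
        ∃ P : Polynomial (PadicAlgCl p), ρ.HasFrobCharpolyAt v P ∧ σ.HasFrobCharpolyAt v P := by
    filter_upwards [hS.compl_mem_cofinite, hev,
      eventually_natCast_not_mem_asIdeal (F := F) (Fact.out : p.Prime).ne_zero,
      eventually_not_le_asIdeal h𝔣] with v hvS hv hvp hv𝔣
    obtain ⟨h1u, h1c⟩ := hr₁ v hvp hv𝔣
    obtain ⟨h2u, h2c⟩ := hr₂ v hvp hv𝔣
    obtain ⟨hσu, hσc⟩ := hσ v h1u h2u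
    rw [inv_inv] at h1c h2c
    refine ⟨(hass v hvS).1, hσu, _, (hass v hvS).2, ?_⟩
    have e₁ : a v 1 = ι.symm (ψ₁ v) + ι.symm (ψ₂ v) := by
      apply ι.injective
      rw [map_add, RingEquiv.apply_symm_apply, RingEquiv.apply_symm_apply, hv.1]
    have e₂ : ((Ideal.absNorm v.asIdeal : ℕ) : PadicAlgCl p) * a v 2 = ι.symm (ψ₁ v) * ι.symm (ψ₂ v) := by
      apply ι.injective
      rw [map_mul, map_mul, map_natCast, RingEquiv.apply_symm_apply, RingEquiv.apply_symm_apply, hv.2]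
    rw [heckeFrobPoly_two_eq (Ideal.absNorm v.asIdeal) (a v) _ _ e₁ e₂]
    exact hσc _ _ h1c h2c
  obtain ⟨e⟩ := FramedGaloisRep.nonempty_equiv_of_hasFrobCharpolyAt_eventually
    chebotarev_artinRep_holds ρ σ (isSemisimple_of_isIrreducible ρ hirr) hσss hboth
  haveI : ρ.toGaloisRep.toRepresentation.IsIrreducible := hirr
  exact hσred
    (Literature.RepresentationTheory.Semisimple.Representation.isIrreducible_of_equiv e.toRepEquiv)

/-! ## X4 — the `C → L` Satake dictionary (proved): `π = π₀^∨ ⊗ |det|^{1/2}` -/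

/-- **The unramified dictionary, family form.** If `ρ` is associated with the eigensystem `a` off
the finite set `S` (`IsAssociatedFamily 2 S a ρ`) and `a` is, through `ι`, the eigensystem of a
regular algebraic cuspidal `π₀` in the normalisation of `HasSatakeParamAt`
(`ι a_{w,1} = q_w^{1/2} e₁(α_w)`, `ι a_{w,2} = e₂(α_w)` a.e.), then
`π := (π₀ ⊗ ω_{π₀}⁻¹∘det) ⊗ |det|^{1/2}` (`= π₀^∨ ⊗ |det|^{1/2}` for `GL₂`) is cuspidal, `L`-algebraic and
satisfies the summit's `SatakeFrobCompatibleAt ι π ρ v` at almost all `v` — verbatim the argument of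
the landed `stub_satakeDictionary` (route `SkinnerWilesDefectOne`), which is field-independent.
[cite: BuzzardGeeLMS2014, Def. 3.1.1 and §5.3] [cite: BorelJacquet1979, 5.7] -/
theorem exists_isLAlgebraic_satakeFrobCompatible_of_cuspidal {F : Type} [Field F] [NumberField F]
    {p : ℕ} [Fact p.Prime] (hcpt : isCompact_glFiniteIntegralLevel 2 F) (ι : PadicAlgCl p ≃+* ℂ)
    (ρ : FramedGaloisRep F (PadicAlgCl p) 2) {S : Set (HeightOneSpectrum (𝓞 F))} (hS : S.Finite)
    {a : HeightOneSpectrum (𝓞 F) → ℕ → PadicAlgCl p} (hass : IsAssociatedFamily 2 S a ρ)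
    (π₀ : CuspidalAutomorphicRepData 2 F hcpt) (hreg : π₀.1.IsRegularAlgebraic)
    (hmatch : ∀ᶠ w : HeightOneSpectrum (𝓞 F) in cofinite, ∃ α : Multiset ℂ,
      π₀.1.HasSatakeParamAt w α ∧
        ι (a w 1) = ((Real.sqrt (w.residueCard : ℝ) : ℝ) : ℂ) * α.esymm 1 ∧ ι (a w 2) = α.esymm 2) :
    ∃ π : CuspidalAutomorphicRepData 2 F hcpt, π.1.IsLAlgebraic ∧
      ∀ᶠ v : HeightOneSpectrum (𝓞 F) in cofinite, Summit.Langlands.SatakeFrobCompatibleAt ι π.1 ρ v := by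
  -- the central character `ω` of `π₀` and the twist `π₁ = π₀ ⊗ (ω⁻¹ ∘ det)` (`= π₀^∨`)
  obtain ⟨ω, hωact, hωsat⟩ := π₀.1.exists_centralCharacter
  obtain ⟨π₁, hW₁, hW₁'⟩ := exists_cuspidalAutomorphicRepData_twist_hecke ω⁻¹ π₀
  have hreg₁ : π₁.1.IsRegularAlgebraic :=
    AutomorphicRepData.IsRegularAlgebraic.of_map_mulChar_detTwist_centralInv hωact hW₁ hW₁' hreg
  have htw₁ := AutomorphicRepData.eventually_hasSatakeParamAt_of_map_mulChar_detTwist ω⁻¹ hW₁ hW₁'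
  -- the half twist `π = π₁ ⊗ |det|^{1/2}`, `L`-algebraic
  obtain ⟨χ, π, T', hχ, hW, hW', hT', -, hL⟩ := π₁.exists_twist_isRegular_isLAlgebraic hreg₁
  refine ⟨π, ⟨T', hT', hL⟩, ?_⟩
  filter_upwards [hmatch, htw₁, hS.compl_mem_cofinite] with v hv htwv hvS
  obtain ⟨α, hα, h1, h2⟩ := hv
  obtain ⟨hρunr, hρfrob⟩ := hass v hvS
  -- `α = {α₁, α₂}` with `α₁ α₂ = ω(ϖ_v) ≠ 0`
  obtain ⟨α₁, α₂, rfl⟩ := Multiset.card_eq_two.1 hα.card_eq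
  obtain ⟨-, hωv⟩ := hωsat hα
  rw [prod_pair] at hωv
  have hprod : α₁ * α₂ ≠ 0 := hωv ▸ valueAtUniformizer_ne_zero ω v
  rw [esymm_one_pair] at h1
  rw [esymm_two_pair] at h2
  -- Satake parameters of `π₁` and `π` at `v`
  have hβ₁ := htwv _ hα
  have hβ := AutomorphicRepData.HasSatakeParamAt.of_map_mulChar_detTwist_of_cpow hχ hW hW' hβ₁
  refine ⟨_, hβ, hρunr, ?_⟩
  -- the Frobenius polynomial
  have hc₁ : ω⁻¹.valueAtUniformizer v * (α₁ * α₂) = 1 := by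
    rw [valueAtUniformizer_inv, hωv, inv_mul_cancel₀ hprod]
  have key := heckeFrobPoly_two_eq_arithFrobPolyOfSatake ι v.residueCard (a v) h1 h2
    (left_ne_zero_of_mul hprod) (right_ne_zero_of_mul hprod) hc₁
    (halfTwist_mul_sqrt (Nat.zero_lt_of_lt v.one_lt_residueCard))
  rw [← key]
  exact hρfrob

/-! ## The stub modulo the named fact -/

/-- **Stub S5 modulo Harder's theorem** — the registered signature of `stub_eichlerShimuraHarder`
VERBATIM, with the tree's named fact `ResGLnCohomology.Harder1987_eigensystem_cuspidalOrEisenstein`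
(unproved: no `_holds` theorem yet) as the only hypothesis.  The eigen-equations at `v ∉ S`, `v ∤ 𝔫` (`S` finite, finitely many `v ∣ 𝔫`) hold at
almost all `v`; Harder's dichotomy on the receptacle (with `E = ℚ̄_p`, transported along `ι`) gives
either a regular algebraic cuspidal `π₀` carrying the eigensystem — turned into an `L`-algebraic `π`
with `SatakeFrobCompatibleAt` a.e. by the dictionary `exists_isLAlgebraic_satakeFrobCompatible_of_cuspidal`
— or a pair of Größencharaktere, excluded by `not_grossencharakterPair_of_isIrreducible`. [folklore] -/
theorem stub_eichlerShimuraHarder_of_harder1987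
    (hH : ResGLnCohomology.Harder1987_eigensystem_cuspidalOrEisenstein) :
    ∀ (F : Type) [Field F] [NumberField F], NumberField.IsTotallyReal F → ∀ (p : ℕ) [Fact p.Prime] (hcpt : Literature.NumberTheory.Automorphic.isCompact_glFiniteIntegralLevel 2 F) (ι : PadicAlgCl p ≃+* ℂ) (ρ : Literature.NumberTheory.GaloisRepresentations.FramedGaloisRep F (PadicAlgCl p) 2), ρ.toGaloisRep.IsIrreducible → ∀ (S : Set (IsDedekindDomain.HeightOneSpectrum (NumberField.RingOfIntegers F))), S.Finite → ∀ (a : IsDedekindDomain.HeightOneSpectrum (NumberField.RingOfIntegers F) → ℕ → PadicAlgCl p), Literature.NumberTheory.Automorphic.BigHeckeGLn.IsAssociatedFamily 2 S a ρ → ∀ (𝔫 : Ideal (NumberField.RingOfIntegers F)), 𝔫 ≠ 0 → ∀ (lam : (F →+* PadicAlgCl p) → Fin 2 → ℤ) (q : ℕ) (c : Literature.NumberTheory.Automorphic.ResGLnCohomology.levelCohomology (PadicAlgCl p) 2 F 𝔫 lam q), c ≠ 0 → (∀ v ∉ S, ¬ v.asIdeal ∣ 𝔫 → ∀ i : ℕ,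 1 ≤ i → i ≤ 2 → Literature.NumberTheory.Automorphic.ResGLnCohomology.heckeT (PadicAlgCl p) 2 F 𝔫 lam q v i c = a v i • c) → ∃ π : Literature.NumberTheory.Automorphic.CuspidalAutomorphicRepData 2 F hcpt, π.1.IsLAlgebraic ∧ ∀ᶠ v in cofinite, Summit.Langlands.SatakeFrobCompatibleAt ι π.1 ρ v := by
  intro F _ _ hF p _ hcpt ι ρ hirr S hS a hass 𝔫 h𝔫 lam q c hc heig
  -- the eigen-equations hold at almost all places
  have h𝔫' : 𝔫 ≠ ⊥ := h𝔫
  have hev : ∀ᶠ w in Filter.cofinite,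
      ResGLnCohomology.heckeT (PadicAlgCl p) 2 F 𝔫 lam q w 1 c = a w 1 • c ∧
        ResGLnCohomology.heckeT (PadicAlgCl p) 2 F 𝔫 lam q w 2 c = a w 2 • c := by
    filter_upwards [hS.compl_mem_cofinite, (Ideal.finite_factors h𝔫').compl_mem_cofinite]
      with w hwS hw𝔫
    exact ⟨heig w hwS hw𝔫 1 le_rfl one_le_two, heig w hwS hw𝔫 2 one_le_two le_rfl⟩
  -- Harder's dichotomy
  rcases hH F hF hcpt (PadicAlgCl p) ι 𝔫 h𝔫 lam q c hc a hev with
    ⟨π₀, hreg, hmatch⟩ | ⟨𝔣, p₁, q₁, p₂, q₂, ψ₁, ψ₂, h𝔣, hψ₁, hψ₂, hEis⟩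
  · exact exists_isLAlgebraic_satakeFrobCompatible_of_cuspidal hcpt ι ρ hS hass π₀ hreg hmatch
  · exact (not_grossencharakterPair_of_isIrreducible ι ρ hirr hS hass h𝔣 hψ₁ hψ₂ hEis).elim

/-- **Stub S5 (registered signature, lead rev 3)**: the Eichler–Shimura–Harder dictionary with
Eisenstein exclusion from Harder's exhaustion fact — `stub_eichlerShimuraHarder_of_harder1987` with the
fact as the leading hypothesis. [folklore] -/
theorem stub_eichlerShimuraHarder : Literature.NumberTheory.Automorphic.ResGLnCohomology.Harder1987_eigensystem_cuspidalOrEisenstein → ∀ (F : Type) [Field F] [NumberField F], NumberField.IsTotallyReal F → ∀ (p : ℕ) [Fact p.Prime] (hcpt : Literature.NumberTheory.Automorphic.isCompact_glFiniteIntegralLevel 2 F) (ι : PadicAlgCl p ≃+* ℂ) (ρ : Literature.NumberTheory.GaloisRepresentations.FramedGaloisRep F (PadicAlgCl p) 2), ρ.toGaloisRep.IsIrreducible → ∀ (S : Set (IsDedekindDomain.HeightOneSpectrum (NumberField.RingOfIntegers F))), S.Finite → ∀ (a : IsDedekindDomain.HeightOneSpectrum (NumberField.RingOfIntegers F) → ℕ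 → PadicAlgCl p), Literature.NumberTheory.Automorphic.BigHeckeGLn.IsAssociatedFamily 2 S a ρ → ∀ (𝔫 : Ideal (NumberField.RingOfIntegers F)), 𝔫 ≠ 0 → ∀ (lam : (F →+* PadicAlgCl p) → Fin 2 → ℤ) (q : ℕ) (c : Literature.NumberTheory.Automorphic.ResGLnCohomology.levelCohomology (PadicAlgCl p) 2 F 𝔫 lam q), c ≠ 0 → (∀ v ∉ S, ¬ v.asIdeal ∣ 𝔫 → ∀ i : ℕ, 1 ≤ i → i ≤ 2 → Literature.NumberTheory.Automorphic.ResGLnCohomology.heckeT (PadicAlgCl p) 2 F 𝔫 lam q v i c = a v i • c) → ∃ π : Literature.NumberTheory.Automorphic.CuspidalAutomorphicRepData 2 F hcpt, π.1.IsLAlgebraic ∧ ∀ᶠ v in cofinite, Summit.Langlands.SatakeFrobCompatibleAt ι π.1 ρ v :=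
  stub_eichlerShimuraHarder_of_harder1987

end

end Summit.Langlands.Langlands.Cruxes.CrystallineProModularClassical.TorsionWeightExchange
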